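import Literature.Computability.AlgebraicComplexity.MS2001StableObstructionMultiplicityComplex
import Literature.Computability.AlgebraicComplexity.BI17GenericBinaryCubicPeriod
import HarnessLib

/-!
# GCT I, Thm. 5.1, MULTIPLICITY form over `ℂ` — III: every finite-dimensional rational module
# (Mulmuley–Sohoni 2001, Thm. 5.1: «a (nonzero) representation `W` of `G` is an obstruction … More
# generally, `W` is an obstruction for `(f, g)` if the multiplicity of the trivial `H`-representation
# within `W` exceeds that of the trivial `Q`-representation»)

Third file (THEOREMS ONLY: no definition, no named fact; D-0026) of the slice-free proof of GCT I
Thm. 5.1 over `ℂ`. Parts I–II (`MS2001StableObstructionMultiplicity*.lean`) prove the theorem for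
the modules `W = Sym^r` of the typed fact `MS2001_thm_5_1` (whose docstring records
`TODO(general form)`: «MS state Thm. 5.1 for an arbitrary finite-dimensional rational `G`-module
`W`»). Here the SAME argument is run for an arbitrary finite-dimensional rational
`GL_σ(ℂ)`-module `(V, ρ)` (the tree's `IsRationalRep`; restrictions of rational `GL`-modules are the
rational `SL`-modules of MS's «a representation `W` of `G`», `G = SL`), and the cone reduction of
part II is freed from the ordering of the variables:

* § 1 `exists_smul_sl_coe_eq` (`GL_σ(ℂ) = ℂ^× · SL_σ(ℂ)`), `exists_isSLInvariantCoord_aeval_ne_zero`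
  (Hilbert's non-vanishing invariant at a polystable form `f ≠ 0`, ANY finite variable type — the
  tree's `Fin n` theorem moved along `degreeMonoid_subset_degreeMonoid_rename`), and the cone
  reduction `exists_smul_mem_zariskiClosure_slOrbit_of_mem_orbitClosure'` for any finite `σ`.
* § 2 the `f` side (`exists_orbitPullback_of_mem_invariants`: matrix coefficients of
  `SL ∩ G_f`-invariant vectors are pull-backs along the closed orbit — `IsRationalRep` +
  `Grosshans1997_thm_1_11_slOrbit_forms_holds`), the `g` side (`invariant_of_orbitPullback`:
  evaluation at `1`), and the transfer `exists_injective_linearMap_invariants_of_orbitPullback`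
  (equivariant lift through `ℂ[Sym^m]_{≤D}`, as in part I § 3).
* § 3 **`finrank_invariants_le_of_mem_orbitClosure`**: for `f` polystable of degree `m` with
  `f ∈ Δ[g]` and every finite-dimensional rational `GL_σ(ℂ)`-module `V`,
  `dim V^{SL ∩ G_f} ≤ dim V^{SL ∩ G_g}`; contrapositive **`MS2001_thm_5_1_modules_complex`**
  («`W` is an obstruction for `(f, g)`»); and `invariant_iff_orbitPullback` (Frobenius reciprocity
  for the closed orbit as an equivalence: the `f`-realisable vectors are exactly `V^{SL ∩ G_f}`).

Honest framing: completes the `ℂ` case of GCT I Thm. 5.1 for all rational modules; the named fact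
`MS2001_thm_5_1` (all algebraically closed fields of characteristic `0`) is NOT discharged. Nothing
here bears on VP versus VNP.

## References

* [MulmuleySohoniSIAM2001] K. D. Mulmuley, M. Sohoni, *Geometric complexity theory I*, SIAM J.
  Comput. 31 (2001) 496–526; authors' version (2001-04-23), Thm. 5.1 and proof, p. 20
  (all.txt L1365–1390).
* [Grosshans1997] F. D. Grosshans, *Algebraic Homogeneous Spaces and Invariant Theory*, LNM 1673
  (1997), Thm. 1.11 and §1 — through `SLOrbitQuotientHolds.lean`.
* [BurgisserIkenmeyer2017] P. Bürgisser, C. Ikenmeyer, *Fundamental invariants of orbit closures*,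
  J. Algebra 477 (2017), Def. 3.3 (degree monoid), proof of Prop. 3.9 (1).

## Provenance

Cell `val-lit`, seat `val-lit-t02` generation 8 (row MS2001-A / MS2008 lineage).
-/

noncomputable section

open MvPolynomial Representation
open scoped Matrix
open _root_.Filter _root_.Topology
open Literature.NumberTheory.Automorphic (GLCoord glCoordFun)
open Literature.NumberTheory.DiophantineGeometry (IsRationalRep)
open Literature.RepresentationTheory.AlgebraicGroups (isSemisimpleRepresentation_specialLinear)

namespace Literature.Computability.AlgebraicComplexity

/-! ### § 1 Cone reduction for any finite variable type -/

section Cone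

variable {σ : Type*} [Fintype σ] [DecidableEq σ]

/-- **`GL_σ(ℂ) = ℂ^× · SL_σ(ℂ)`** (`σ` non-empty): every invertible matrix is a non-zero scalar times a
matrix of determinant one (take a `|σ|`-th root of the determinant).
[cite: BurgisserIkenmeyer2017, Lemma 3.2 (1) (proof: «for `g = t id_m` we have `det(g) = t^m`»)] -/
theorem exists_smul_sl_coe_eq (hσ : 0 < Fintype.card σ) (A : GL σ ℂ) :
    ∃ (s : ℂ) (h : Matrix.SpecialLinearGroup σ ℂ), s ≠ 0 ∧
      (A : Matrix σ σ ℂ) = s • (h : Matrix σ σ ℂ) := by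
  obtain ⟨s, hs⟩ := IsAlgClosed.exists_pow_nat_eq (Matrix.det (A : Matrix σ σ ℂ)) hσ
  have hs0 : s ≠ 0 := by
    rintro rfl
    rw [zero_pow hσ.ne'] at hs
    exact (Matrix.isUnits_det_units A).ne_zero hs.symm
  refine ⟨s, ⟨s⁻¹ • (A : Matrix σ σ ℂ), ?_⟩, hs0, ?_⟩
  · rw [Matrix.det_smul, ← hs, inv_pow, inv_mul_cancel₀ (pow_ne_zero _ hs0)]
  · change (A : Matrix σ σ ℂ) = s • (s⁻¹ • (A : Matrix σ σ ℂ))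
    rw [smul_smul, mul_inv_cancel₀ hs0, one_smul]

/-- Values of a homogeneous polynomial at a rescaled point: `F(c • x) = c ^ d * F(x)`. [folklore] -/
private theorem aeval_smul_pt_of_isHomogeneous₃ {ι : Type*} {F : MvPolynomial ι ℂ} {d : ℕ}
    (hF : F.IsHomogeneous d) (c : ℂ) (x : ι → ℂ) : aeval (c • x) F = c ^ d * aeval x F := by
  classical
  rw [F.as_sum, map_sum, map_sum, Finset.mul_sum]
  refine Finset.sum_congr rfl fun s hs => ?_
  simp only [aeval_monomial, Pi.smul_apply, smul_eq_mul, mul_pow, Finsupp.prod,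
    Finset.prod_mul_distrib]
  rw [Finset.prod_pow_eq_pow_sum, ← hF.degree_eq_sum_deg_support hs]
  ring

/-- The zero locus of an ideal of polynomial functions is closed in the classical topology of `ℂ^ι`.
[folklore] -/
private theorem isClosed_zeroLocus₃ {ι : Type*} (I : Ideal (MvPolynomial ι ℂ)) :
    IsClosed (MvPolynomial.zeroLocus ℂ I) := by
  have h : MvPolynomial.zeroLocus ℂ I = ⋂ p : I, {x : ι → ℂ | aeval x (p : MvPolynomial ι ℂ) = 0} := by
    ext x
    rw [MvPolynomial.mem_zeroLocus_iff, Set.mem_iInter]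
    exact ⟨fun h p => h p p.2, fun h p hp => h ⟨p, hp⟩⟩
  rw [h]
  exact isClosed_iInter fun p =>
    isClosed_eq (Literature.NumberTheory.Transcendental.AlgHomClosure.continuous_aeval _) continuous_const

/-- **Hilbert's non-vanishing invariant at a polystable form, any finite variable type**: for a
polystable form `f ≠ 0` of degree `D` there is a homogeneous `SL_σ(ℂ)`-invariant polynomial function
on `Sym^D` of positive degree not vanishing at `f` (the tree's `Fin n` theorem
`exists_isSLInvariantCoord_aeval_formCoeff_ne_zero`, transported along a numbering of `σ` through the
degree monoid `E(f)` — `degreeMonoid_subset_degreeMonoid_rename` — and read back at `f` by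
`SL`-invariance and homogeneity along `GL·f = ℂ^× SL·f`).
[cite: MumfordFogartyKirwan1994, Ch. 2 §1 Prop. 2.2 (proof)] [cite: BurgisserIkenmeyer2017, Def. 3.3] -/
theorem exists_isSLInvariantCoord_aeval_ne_zero (hσ : 0 < Fintype.card σ) {f : MvPolynomial σ ℂ}
    {D : ℕ} (hf : f.IsHomogeneous D) (hf0 : f ≠ 0) (hst : IsPolystable f) :
    ∃ (F : MvPolynomial (DegIdx σ D) ℂ) (d : ℕ), 0 < d ∧ F.IsHomogeneous d ∧
      IsSLInvariantCoord D F ∧ aeval (formCoeff D f) F ≠ 0 := by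
  classical
  set e : σ ≃ Fin (Fintype.card σ) := Fintype.equivFin σ with he
  have hf' : (rename e f).IsHomogeneous D := hf.rename_isHomogeneous
  have hf0' : rename e f ≠ 0 := fun h0 =>
    hf0 (rename_injective e e.injective (by rw [h0, map_zero]))
  obtain ⟨d, hd, hdpos⟩ := exists_pos_mem_degreeMonoid hσ hf' hf0' (hst.rename_equiv e)
  have hd' : d ∈ degreeMonoid D f := by
    have h1 := degreeMonoid_subset_degreeMonoid_rename e.symm D (rename e f) hd
    rwa [rename_rename, e.symm_comp_self, rename_id_apply] at h1
  obtain ⟨F, hFh, hFi, hFI⟩ := hd'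
  refine ⟨F, d, hdpos, hFh, hFi, fun hFf => hFI ?_⟩
  -- `F(A·f) = (s^D)^d F(f) = 0` along `GL·f = ℂ^× SL·f`
  rw [mem_orbitVanishingIdeal_iff]
  intro A
  obtain ⟨s, h, -, hA⟩ := exists_smul_sl_coe_eq hσ A
  rw [linSubstRep_apply, hA, linSubst_smul_of_isHomogeneous hf, formCoeff_smul,
    aeval_smul_pt_of_isHomogeneous₃ hFh, hFi.aeval_formCoeff_linSubst h f, hFf, mul_zero]

/-- **Cone reduction, any finite variable type** (part II's
`exists_smul_mem_zariskiClosure_slOrbit_of_mem_orbitClosure` with `Fin n` replaced by `σ`): over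
`ℂ`, if a polystable form `f ≠ 0` of degree `D` lies in `Δ[g] = \overline{GL·g}` for a form `g` of
degree `D`, then some non-zero multiple `c • f` lies (coefficientwise) in the Zariski closure of
`SL·g`. Same Euclidean proof (Bürgisser–Ikenmeyer, proof of Prop. 3.9 (1)).
[cite: MulmuleySohoniSIAM2001, Thm. 5.1, proof (AV p.20, all.txt L1374–1390)]
[cite: BurgisserIkenmeyer2017, Prop. 3.9 (1) (proof)] -/
theorem exists_smul_mem_zariskiClosure_slOrbit_of_mem_orbitClosure' (hσ : 0 < Fintype.card σ)
    {D : ℕ} {f g : MvPolynomial σ ℂ} (hf : f.IsHomogeneous D) (hg : g.IsHomogeneous D) (hf0 : f ≠ 0)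
    (hst : IsPolystable f) (hmem : f ∈ orbitClosure g) :
    ∃ c : ℂ, c ≠ 0 ∧ coeffVec (c • f) ∈ zariskiClosure (coeffVec '' slOrbit σ ℂ g) := by
  classical
  -- (1) a sequence `A k ∈ GL` with `A k · g → f` coefficientwise
  have hfc : (fun d : {d : σ →₀ ℕ // d.degree = D} => coeffVec f d.1) ∈
      closure ((fun q (d : {d : σ →₀ ℕ // d.degree = D}) => coeffVec q d.1) '' glOrbit σ ℂ g) := by
    rw [← orbitClosure_eq_euclidean_closure_complex_holds (σ := σ) hg]
    exact ⟨f, hmem, rfl⟩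
  haveI : Fintype {d : σ →₀ ℕ // d.degree = D} :=
    Fintype.subtype ((Finset.univ : Finset σ).finsuppAntidiag D) fun d => by
      simp [Finset.mem_finsuppAntidiag, Finsupp.degree_eq_sum]
  obtain ⟨x, hxmem, hxlim⟩ := mem_closure_iff_seq_limit.1 hfc
  choose p hp hpx using hxmem
  choose A hA using hp
  have hylim : Tendsto (fun k => formCoeff D (linSubstRep σ ℂ (A k) g)) atTop
      (𝓝 (formCoeff D f)) := by
    rw [tendsto_pi_nhds]
    intro d
    have hd : d.1.degree = D := mem_degMonomials_iff.1 d.2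
    have h1 := tendsto_pi_nhds.1 hxlim ⟨d.1, hd⟩
    have h2 : (fun k => x k ⟨d.1, hd⟩) = fun k => formCoeff D (linSubstRep σ ℂ (A k) g) d := by
      funext k
      rw [← hpx k, ← hA k]
      rfl
    rwa [h2] at h1
  -- (2) `A k = s k • h k`, `h k ∈ SL`
  choose s h hs0 hdec using fun k => exists_smul_sl_coe_eq hσ (A k)
  have hy : ∀ k, formCoeff D (linSubstRep σ ℂ (A k) g) =
      s k ^ D • formCoeff D (linSubst σ ℂ (h k : Matrix σ σ ℂ) g) := by
    intro k
    rw [linSubstRep_apply, hdec k, linSubst_smul_of_isHomogeneous hg, formCoeff_smul]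
  -- (3) an `SL`-invariant `Φ`, homogeneous of degree `e ≥ 1`, with `Φ(f) ≠ 0`; `Φ(g) ≠ 0`
  obtain ⟨Φ, e, he, hΦh, hΦi, hΦf⟩ := exists_isSLInvariantCoord_aeval_ne_zero hσ hf hf0 hst
  have hΦval : ∀ k, aeval (formCoeff D (linSubstRep σ ℂ (A k) g)) Φ =
      (s k ^ D) ^ e * aeval (formCoeff D g) Φ := by
    intro k
    rw [hy k, aeval_smul_pt_of_isHomogeneous₃ hΦh, hΦi.aeval_formCoeff_linSubst (h k) g]
  have hΦlim : Tendsto (fun k => (s k ^ D) ^ e * aeval (formCoeff D g) Φ) atTop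
      (𝓝 (aeval (formCoeff D f) Φ)) := by
    have h1 := ((Literature.NumberTheory.Transcendental.AlgHomClosure.continuous_aeval Φ).tendsto
      _).comp hylim
    have h2 : (fun w : DegIdx σ D → ℂ => aeval w Φ) ∘
        (fun k => formCoeff D (linSubstRep σ ℂ (A k) g)) =
        fun k => (s k ^ D) ^ e * aeval (formCoeff D g) Φ := by
      funext k
      exact hΦval k
    rwa [h2] at h1
  have hΦg : aeval (formCoeff D g) Φ ≠ 0 := by
    intro h0
    simp_rw [h0, mul_zero] at hΦlim
    exact hΦf (tendsto_nhds_unique hΦlim tendsto_const_nhds)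
  -- (4) `(s k ^ D) ^ e → Φ(f) / Φ(g)`, so `(s k ^ D)` is bounded
  have htlim : Tendsto (fun k => (s k ^ D) ^ e) atTop
      (𝓝 (aeval (formCoeff D f) Φ * (aeval (formCoeff D g) Φ)⁻¹)) := by
    have h1 := hΦlim.mul_const ((aeval (formCoeff D g) Φ)⁻¹)
    have h2 : (fun k => (s k ^ D) ^ e * aeval (formCoeff D g) Φ * (aeval (formCoeff D g) Φ)⁻¹) =
        fun k => (s k ^ D) ^ e := by
      funext k
      rw [mul_assoc, mul_inv_cancel₀ hΦg, mul_one]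
    rwa [h2] at h1
  obtain ⟨M, hM⟩ := (Metric.isBounded_range_of_tendsto _ htlim).exists_norm_le
  have htb : ∀ k, ‖s k ^ D‖ ≤ max M 1 := by
    intro k
    by_cases hle : ‖s k ^ D‖ ≤ 1
    · exact hle.trans (le_max_right _ _)
    · rw [not_le] at hle
      have h1 : ‖s k ^ D‖ ≤ ‖s k ^ D‖ ^ e := le_self_pow₀ hle.le he.ne'
      rw [← norm_pow] at h1
      exact (h1.trans (hM _ ⟨k, rfl⟩)).trans (le_max_left _ _)
  -- (5) Bolzano–Weierstrass: `s (φ k) ^ D → δ ≠ 0`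
  obtain ⟨δ, -, φ, hφ, hδ⟩ := tendsto_subseq_of_bounded (Metric.isBounded_closedBall (x := (0 : ℂ))
    (r := max M 1)) (x := fun k => s k ^ D) fun k => by
      rw [Metric.mem_closedBall, dist_zero_right]; exact htb k
  have hδ0 : δ ≠ 0 := by
    intro hδ0
    have h1 : Tendsto (fun k => (s (φ k) ^ D) ^ e) atTop (𝓝 (δ ^ e)) := hδ.pow e
    have h2 := htlim.comp hφ.tendsto_atTop
    have h3 := tendsto_nhds_unique h1 h2
    rw [hδ0, zero_pow he.ne'] at h3
    exact mul_ne_zero hΦf (inv_ne_zero hΦg) h3.symm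
  -- (6) `h (φ k) · g → δ⁻¹ • f`, a point of the closed set `Z(I(SL·g))`
  have hylim' := hylim.comp hφ.tendsto_atTop
  have hzlim : Tendsto (fun k => formCoeff D (linSubst σ ℂ (h (φ k) : Matrix σ σ ℂ) g)) atTop
      (𝓝 (δ⁻¹ • formCoeff D f)) := by
    have heq : (fun k => formCoeff D (linSubst σ ℂ (h (φ k) : Matrix σ σ ℂ) g)) =
        fun k => (s (φ k) ^ D)⁻¹ • formCoeff D (linSubstRep σ ℂ (A (φ k)) g) := by
      funext k
      rw [hy (φ k), smul_smul, inv_mul_cancel₀ (pow_ne_zero _ (hs0 _)), one_smul]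
    rw [heq]
    exact (hδ.inv₀ hδ0).smul hylim'
  have hZcl : IsClosed (MvPolynomial.zeroLocus ℂ
      (MvPolynomial.vanishingIdeal ℂ (formCoeff D '' slOrbit σ ℂ g))) := isClosed_zeroLocus₃ _
  have hmemZ : δ⁻¹ • formCoeff D f ∈ MvPolynomial.zeroLocus ℂ
      (MvPolynomial.vanishingIdeal ℂ (formCoeff D '' slOrbit σ ℂ g)) :=
    hZcl.mem_of_tendsto hzlim (Eventually.of_forall fun k =>
      MvPolynomial.zeroLocus_vanishingIdeal_le _ ⟨_, ⟨h (φ k), rfl⟩, rfl⟩)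
  -- (7) back to the all-monomial coordinates
  refine ⟨δ⁻¹, inv_ne_zero hδ0, ?_⟩
  refine coeffVec_mem_zariskiClosure_of_formCoeff_mem_zeroLocus (m := D)
    (fun P hP => isHomogeneous_of_mem_slOrbit hg P hP)
    ((mem_homogeneousSubmodule D _).mp ((homogeneousSubmodule σ ℂ D).smul_mem δ⁻¹
      ((mem_homogeneousSubmodule D f).mpr hf))) ?_
  rw [formCoeff_smul]
  exact hmemZ

end Cone

/-! ### § 2 The three steps for a general rational module -/

section Modules

variable {σ : Type} [Fintype σ] [LinearOrder σ]

/-- **The `f` side for a general module** (GCT I Thm. 5.1, «`k[Gf] = k[G/H]`» AV p. 20 L1398–1399,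
with Frobenius reciprocity): for a polystable form `f` of degree `m`, a finite-dimensional rational
`GL_σ(ℂ)`-module `(V, ρ)` and a vector `v` fixed by `SL ∩ G_f`, every matrix coefficient
`s ↦ μ(ρ(s) v)` on `SL_σ(ℂ)` is a pull-back `s ↦ F(s·f)` of a polynomial on `Sym^m`
(`IsRationalRep`: the coefficient is polynomial on `SL`; right-invariance under the stabiliser;
`Grosshans1997_thm_1_11_slOrbit_forms_holds`).
[cite: MulmuleySohoniSIAM2001, Thm. 5.1, proof (AV p.20, all.txt L1374–1399)] [cite: Grosshans1997, Thm. 1.11 and §1] -/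
theorem exists_orbitPullback_of_mem_invariants {f : MvPolynomial σ ℂ} {m : ℕ}
    (hf : f.IsHomogeneous m) (hst : IsPolystable f)
    {V : Type*} [AddCommGroup V] [Module ℂ V] (ρ : Representation ℂ (GL σ ℂ) V)
    (hρ : IsRationalRep ρ) {v : V}
    (hv : ∀ γ ∈ slSubgroup σ ℂ ⊓ linStabilizer f, ρ γ v = v) (μ : Module.Dual ℂ V) :
    ∃ F : MvPolynomial (DegIdx σ m) ℂ, ∀ s : ↥(slSubgroup σ ℂ),
      μ (ρ (s : GL σ ℂ) v) = aeval (formCoeff m (linSubstRep σ ℂ (s : GL σ ℂ) f)) F := by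
  classical
  obtain ⟨P, r, hP⟩ := hρ v μ
  -- on elements of determinant one the coefficient is the polynomial `P`
  have hP1 : ∀ γ : GL σ ℂ, Matrix.det (γ : Matrix σ σ ℂ) = 1 →
      MvPolynomial.eval (fun ij : σ × σ => (γ : Matrix σ σ ℂ) ij.1 ij.2) P = μ (ρ γ v) := by
    intro γ hγ
    have h1 := hP γ
    rw [hγ, one_pow, mul_one] at h1
    exact h1.symm
  have hPinv : ∀ g h : Matrix σ σ ℂ, g.det = 1 → h.det = 1 → linSubst σ ℂ h f = f →
      MvPolynomial.eval (fun ij : σ × σ => (g * h) ij.1 ij.2) P =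
        MvPolynomial.eval (fun ij : σ × σ => g ij.1 ij.2) P := by
    intro g h hg hh hhf
    have hg0 : g.det ≠ 0 := by rw [hg]; exact one_ne_zero
    have hh0 : h.det ≠ 0 := by rw [hh]; exact one_ne_zero
    set G : GL σ ℂ := Matrix.GeneralLinearGroup.mkOfDetNeZero g hg0 with hGdef
    set Hm : GL σ ℂ := Matrix.GeneralLinearGroup.mkOfDetNeZero h hh0 with hHmdef
    have hGH : ((G * Hm : GL σ ℂ) : Matrix σ σ ℂ) = g * h := by rw [Units.val_mul]; rfl
    have hHmem : Hm ∈ slSubgroup σ ℂ ⊓ linStabilizer f :=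
      Subgroup.mem_inf.mpr ⟨mem_slSubgroup_iff.mpr hh, by
        rw [mem_linStabilizer, linSubstRep_apply]; exact hhf⟩
    have e1 := hP1 (G * Hm) (by rw [hGH, Matrix.det_mul, hg, hh, mul_one])
    rw [hGH] at e1
    rw [e1, show (fun ij : σ × σ => g ij.1 ij.2) = fun ij : σ × σ => (G : Matrix σ σ ℂ) ij.1 ij.2
      from rfl, hP1 G hg, map_mul, Module.End.mul_apply, hv _ hHmem]
  obtain ⟨F, hF⟩ := Grosshans1997_thm_1_11_slOrbit_forms_holds.out hf hst hPinv
  refine ⟨F, fun s => ?_⟩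
  have hs : Matrix.det ((s : GL σ ℂ) : Matrix σ σ ℂ) = 1 := mem_slSubgroup_iff.mp s.2
  rw [← hP1 _ hs, hF _ hs, linSubstRep_apply]

/-- **The `g` side for a general module** (evaluation at `1`; «multiplicity of the trivial
`Q`-representation», AV p. 20 L1371): if every matrix coefficient `s ↦ μ(ρ(s) v)` is a pull-back
`s ↦ F_μ(s·g)`, then `v` is fixed by `SL ∩ G_g`. No hypothesis on `g`, `Q` or `ρ`.
[cite: MulmuleySohoniSIAM2001, Thm. 5.1 (AV p.20, all.txt L1365–1372)] [cite: Grosshans1997, §1] -/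
theorem invariant_of_orbitPullback {g : MvPolynomial σ ℂ} {m : ℕ}
    {V : Type*} [AddCommGroup V] [Module ℂ V] (ρ : Representation ℂ (GL σ ℂ) V) {v : V}
    (h : ∀ μ : Module.Dual ℂ V, ∃ F : MvPolynomial (DegIdx σ m) ℂ,
      ∀ s : ↥(slSubgroup σ ℂ), μ (ρ (s : GL σ ℂ) v) =
        aeval (formCoeff m (linSubstRep σ ℂ (s : GL σ ℂ) g)) F) :
    ∀ γ ∈ slSubgroup σ ℂ ⊓ linStabilizer g, ρ γ v = v := by
  intro γ hγ
  obtain ⟨hγSL, hγg⟩ := Subgroup.mem_inf.mp hγ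
  rw [← sub_eq_zero]
  refine (Module.forall_dual_apply_eq_zero_iff ℂ _).mp fun μ => ?_
  obtain ⟨F, hF⟩ := h μ
  have h1 := hF ⟨γ, hγSL⟩
  have h0 := hF 1
  simp only [OneMemClass.coe_one, map_one, Module.End.one_apply] at h0
  rw [map_sub, sub_eq_zero, h0]
  exact h1.trans (by rw [mem_linStabilizer.mp hγg])

/-- `IsCompl` of subrepresentations gives `IsCompl` of the underlying submodules. [folklore] -/
private theorem isCompl_toSubmodule_of_isCompl₄ {G : Type*} [Group G] {V : Type*} [AddCommGroup V]
    [Module ℂ V] {τ : Representation ℂ G V} {T T' : Subrepresentation τ} (h : IsCompl T T') :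
    IsCompl T.toSubmodule T'.toSubmodule := by
  rw [isCompl_iff, disjoint_iff, codisjoint_iff] at h ⊢
  exact ⟨by rw [← Subrepresentation.toSubmodule_inf, h.1]; rfl,
    by rw [← Subrepresentation.toSubmodule_sup, h.2]; rfl⟩

/-- `coordSubst` preserves `totalDegree ≤ D`. [folklore] -/
private theorem coordSubst_mem_restrictTotalDegree₄ {m D : ℕ} (γ : GL σ ℂ)
    {F : MvPolynomial (DegIdx σ m) ℂ} (hF : F ∈ restrictTotalDegree (DegIdx σ m) ℂ D) :
    coordSubst m γ F ∈ restrictTotalDegree (DegIdx σ m) ℂ D := by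
  classical
  rw [mem_restrictTotalDegree] at hF ⊢
  conv_lhs => rw [← sum_homogeneousComponent F]
  rw [map_sum]
  refine (totalDegree_finsetSum _ _).trans (Finset.sup_le fun d hd => ?_)
  have hd' : d ≤ D := (Nat.lt_succ_iff.mp (Finset.mem_range.mp hd)).trans hF
  exact (isHomogeneous_coordSubst γ (homogeneousComponent_isHomogeneous d F)).totalDegree_le.trans hd'

/-- **Transfer along an `SL`-degeneration for a general module** (part I § 3 with `Sym^r`
replaced by any finite-dimensional `GL_σ(ℂ)`-module `V`): if every polynomial on `Sym^m` vanishing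
along `SL·g` vanishes along `SL·f`, and `T ⊆ V` is a subspace all of whose matrix coefficients are
pull-backs along `SL·f`, then `T` embeds linearly into the `SL ∩ G_g`-invariants of `V` (equivariant
lift through the completely reducible `ℂ[Sym^m]_{≤D}`, evaluation along `SL·g`, Frobenius at `1`).
[cite: MulmuleySohoniSIAM2001, Thm. 5.1, proof (AV p.20, all.txt L1374–1390)]
[cite: Grosshans1997, §1 (Frobenius reciprocity for `k[G]^H`)] -/
theorem exists_injective_linearMap_invariants_of_orbitPullback {f g : MvPolynomial σ ℂ} {m : ℕ}
    (hR : ∀ F : MvPolynomial (DegIdx σ m) ℂ,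
      (∀ s : ↥(slSubgroup σ ℂ), aeval (formCoeff m (linSubstRep σ ℂ (s : GL σ ℂ) g)) F = 0) →
      ∀ s : ↥(slSubgroup σ ℂ), aeval (formCoeff m (linSubstRep σ ℂ (s : GL σ ℂ) f)) F = 0)
    {V : Type*} [AddCommGroup V] [Module ℂ V] [FiniteDimensional ℂ V]
    (ρ : Representation ℂ (GL σ ℂ) V) (T : Submodule ℂ V)
    (hTf : ∀ v ∈ T, ∀ μ : Module.Dual ℂ V, ∃ F : MvPolynomial (DegIdx σ m) ℂ,
      ∀ s : ↥(slSubgroup σ ℂ), μ (ρ (s : GL σ ℂ) v) =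
        aeval (formCoeff m (linSubstRep σ ℂ (s : GL σ ℂ) f)) F) :
    ∃ Ψ : T →ₗ[ℂ] V, Function.Injective Ψ ∧
      ∀ t : T, ∀ γ ∈ slSubgroup σ ℂ ⊓ linStabilizer g, ρ γ (Ψ t) = Ψ t := by
  classical
  set SL : Subgroup (GL σ ℂ) := slSubgroup σ ℂ with hSLdef
  -- the two evaluations along the orbits: `Ef F = (s ↦ F(s·f))`, `Eg F = (s ↦ F(s·g))`
  let Ef : MvPolynomial (DegIdx σ m) ℂ →ₗ[ℂ] (↥SL → ℂ) :=
    { toFun := fun F s => aeval (formCoeff m (linSubstRep σ ℂ (s : GL σ ℂ) f)) F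
      map_add' := fun F G => by funext s; simp only [map_add, Pi.add_apply]
      map_smul' := fun a F => by
        funext s; simp only [map_smul, smul_eq_mul, Pi.smul_apply, RingHom.id_apply] }
  let Eg : MvPolynomial (DegIdx σ m) ℂ →ₗ[ℂ] (↥SL → ℂ) :=
    { toFun := fun F s => aeval (formCoeff m (linSubstRep σ ℂ (s : GL σ ℂ) g)) F
      map_add' := fun F G => by funext s; simp only [map_add, Pi.add_apply]
      map_smul' := fun a F => by
        funext s; simp only [map_smul, smul_eq_mul, Pi.smul_apply, RingHom.id_apply] }
  have hEf_apply : ∀ F s, Ef F s = aeval (formCoeff m (linSubstRep σ ℂ (s : GL σ ℂ) f)) F :=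
    fun F s => rfl
  have hEg_apply : ∀ F s, Eg F s = aeval (formCoeff m (linSubstRep σ ℂ (s : GL σ ℂ) g)) F :=
    fun F s => rfl
  have hEf_coordSubst : ∀ (γ s : ↥SL) (F : MvPolynomial (DegIdx σ m) ℂ),
      Ef (coordSubst m (γ : GL σ ℂ) F) s = Ef F (γ⁻¹ * s) := fun γ s F => by
    rw [hEf_apply, hEf_apply, aeval_formCoeff_coordSubst, ← Module.End.mul_apply, ← map_mul,
      Subgroup.coe_mul, Subgroup.coe_inv]
  have hR' : ∀ F, Eg F = 0 → Ef F = 0 := by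
    intro F hF
    funext s
    rw [hEf_apply, Pi.zero_apply]
    refine hR F (fun s' => ?_) s
    rw [← hEg_apply, hF, Pi.zero_apply]
  -- bases of `T` and of `V^*`, and the chosen pull-backs `Fx i j`
  let bT := Module.finBasis ℂ T
  let bW := Module.finBasis ℂ (Module.Dual ℂ V)
  have hchoice : ∀ (i : Fin (Module.finrank ℂ T)) (j : Fin (Module.finrank ℂ (Module.Dual ℂ V))),
      ∃ F : MvPolynomial (DegIdx σ m) ℂ, ∀ s : ↥SL,
        bW j (ρ (s : GL σ ℂ) (bT i : V)) = Ef F s := fun i j => hTf _ (bT i).2 (bW j)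
  choose Fx hFx using hchoice
  set D : ℕ := Finset.univ.sup fun ij : Fin (Module.finrank ℂ T) ×
    Fin (Module.finrank ℂ (Module.Dual ℂ V)) => (Fx ij.1 ij.2).totalDegree with hDdef
  -- `ℓ₀ i : V^* → ℂ[Sym^m]_{≤D}`, a (non-equivariant) lift of `μ ↦ (s ↦ μ(ρ(s) bT i))`
  let ℓ₀ : Fin (Module.finrank ℂ T) → Module.Dual ℂ V →ₗ[ℂ] MvPolynomial (DegIdx σ m) ℂ :=
    fun i => ∑ j, (bW.coord j).smulRight (Fx i j)
  have hℓ₀_apply : ∀ i μ, ℓ₀ i μ = ∑ j, bW.coord j μ • Fx i j := fun i μ => by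
    simp only [ℓ₀, LinearMap.sum_apply, LinearMap.smulRight_apply]
  have hℓ₀E : ∀ i μ s, Ef (ℓ₀ i μ) s = μ (ρ (s : GL σ ℂ) (bT i : V)) := by
    intro i μ s
    calc Ef (ℓ₀ i μ) s = ∑ j, bW.coord j μ * bW j (ρ (s : GL σ ℂ) (bT i : V)) := by
          rw [hℓ₀_apply, map_sum, Finset.sum_apply]
          exact Finset.sum_congr rfl fun j _ => by
            rw [map_smul, Pi.smul_apply, smul_eq_mul, hFx]
      _ = (∑ j, bW.coord j μ • bW j) (ρ (s : GL σ ℂ) (bT i : V)) := by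
          rw [LinearMap.sum_apply]
          exact Finset.sum_congr rfl fun j _ => by rw [LinearMap.smul_apply, smul_eq_mul]
      _ = μ (ρ (s : GL σ ℂ) (bT i : V)) := by
          simp_rw [Module.Basis.coord_apply]; rw [bW.sum_repr]
  have hℓ₀D : ∀ i μ, ℓ₀ i μ ∈ restrictTotalDegree (DegIdx σ m) ℂ D := by
    intro i μ
    rw [hℓ₀_apply]
    refine Submodule.sum_mem _ fun j _ => Submodule.smul_mem _ _ ?_
    rw [mem_restrictTotalDegree]
    exact Finset.le_sup (f := fun ij : Fin (Module.finrank ℂ T) ×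
      Fin (Module.finrank ℂ (Module.Dual ℂ V)) => (Fx ij.1 ij.2).totalDegree) (Finset.mem_univ (i, j))
  -- `M = ℂ[Sym^m]_{≤D}` as an `SL`-subrepresentation of `coordRep`, completely reducible
  let M : Subrepresentation ((coordRep σ ℂ m).comp SL.subtype) :=
    ⟨restrictTotalDegree (DegIdx σ m) ℂ D, fun γ F hF =>
      coordSubst_mem_restrictTotalDegree₄ (γ : GL σ ℂ) hF⟩
  let τ := M.toRepresentation
  have hτ_coe : ∀ (γ : ↥SL) (w : M.toSubmodule),
      ((τ γ w : M.toSubmodule) : MvPolynomial (DegIdx σ m) ℂ) =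
        coordSubst m (γ : GL σ ℂ) (w : MvPolynomial (DegIdx σ m) ℂ) := fun γ w => rfl
  haveI : FiniteDimensional ℂ M.toSubmodule :=
    show Module.Finite ℂ (restrictTotalDegree (DegIdx σ m) ℂ D) from inferInstance
  have hτreg : ∀ (w : M.toSubmodule) (ℓ : Module.Dual ℂ M.toSubmodule),
      ∃ P : MvPolynomial (GLCoord σ) ℂ,
        ∀ g : ↥SL, ℓ (τ g w) = MvPolynomial.eval (glCoordFun (g : GL σ ℂ)) P := by
    intro w ℓ
    set ℓ' : Module.Dual ℂ (MvPolynomial (DegIdx σ m) ℂ) :=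
      Subspace.dualLift (restrictTotalDegree (DegIdx σ m) ℂ D) ℓ with hℓ'
    obtain ⟨P, r, hP⟩ :=
      isRationalRep_coordRep (σ := σ) (k := ℂ) m (w : MvPolynomial (DegIdx σ m) ℂ) ℓ'
    refine ⟨rename Sum.inl P * X (Sum.inr ()) ^ r, fun g => ?_⟩
    have hdet : Matrix.det ((g : GL σ ℂ) : Matrix σ σ ℂ) ≠ 0 :=
      ((Matrix.isUnit_iff_isUnit_det _).mp (g : GL σ ℂ).isUnit).ne_zero
    have hcomp : (glCoordFun (g : GL σ ℂ) ∘ Sum.inl) =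
        fun ij : σ × σ => ((g : GL σ ℂ) : Matrix σ σ ℂ) ij.1 ij.2 := by
      funext ij; rfl
    have h1 : ℓ (τ g w) = ℓ' (coordRep σ ℂ m (g : GL σ ℂ) (w : MvPolynomial (DegIdx σ m) ℂ)) := by
      rw [hℓ', coordRep_apply, ← hτ_coe, Subspace.dualLift_of_subtype]
    rw [map_mul, map_pow, eval_X, Literature.NumberTheory.Automorphic.glCoordFun_inr, eval_rename,
      hcomp, ← hP (g : GL σ ℂ), h1, mul_assoc, ← mul_pow, mul_inv_cancel₀ hdet, one_pow, mul_one]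
  have hτss : τ.IsSemisimpleRepresentation :=
    isSemisimpleRepresentation_specialLinear (M := SL) (fun g => mem_slSubgroup_iff) τ hτreg
  -- the kernel of `Ef` on `M` and an `SL`-stable complement `C`
  let K : Subrepresentation τ :=
    ⟨LinearMap.ker (Ef.comp M.toSubmodule.subtype), fun γ w hw => by
      rw [LinearMap.mem_ker] at hw ⊢
      change Ef ((τ γ w : M.toSubmodule) : MvPolynomial (DegIdx σ m) ℂ) = 0
      rw [hτ_coe]
      funext s
      rw [hEf_coordSubst, show Ef (w : MvPolynomial (DegIdx σ m) ℂ) = 0 from hw]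
      rfl⟩
  have hKmem : ∀ w : M.toSubmodule, w ∈ K.toSubmodule ↔
      Ef (w : MvPolynomial (DegIdx σ m) ℂ) = 0 := fun w => LinearMap.mem_ker
  obtain ⟨C, hKC⟩ := hτss.exists_isCompl K
  have hKC' : IsCompl K.toSubmodule C.toSubmodule := isCompl_toSubmodule_of_isCompl₄ hKC
  have hinjC : ∀ a b : M.toSubmodule, a ∈ C.toSubmodule → b ∈ C.toSubmodule →
      Ef (a : MvPolynomial (DegIdx σ m) ℂ) = Ef (b : MvPolynomial _ ℂ) → a = b := by
    intro a b ha hb hab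
    have hK : a - b ∈ K.toSubmodule := by
      rw [hKmem, Submodule.coe_sub, map_sub, hab, sub_self]
    have hCm : a - b ∈ C.toSubmodule := C.toSubmodule.sub_mem ha hb
    have : a - b ∈ K.toSubmodule ⊓ C.toSubmodule := ⟨hK, hCm⟩
    rw [hKC'.inf_eq_bot, Submodule.mem_bot, sub_eq_zero] at this
    exact this
  -- the projection `q` onto `C` along `K`: `Ef ∘ q = Ef`
  have hdecomp : ∀ w : M.toSubmodule, ∃ k ∈ K.toSubmodule, ∃ w' ∈ C.toSubmodule, k + w' = w :=
    fun w => Submodule.mem_sup.mp (hKC'.sup_eq_top.symm ▸ Submodule.mem_top)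
  choose kpart hkpart wpart hwpart hsum using hdecomp
  let q : M.toSubmodule →ₗ[ℂ] M.toSubmodule :=
    C.toSubmodule.subtype ∘ₗ Submodule.projectionOnto C.toSubmodule K.toSubmodule hKC'.symm
  have hq_mem : ∀ w, q w ∈ C.toSubmodule := fun w =>
    (Submodule.projectionOnto C.toSubmodule K.toSubmodule hKC'.symm w).2
  have hq_eval : ∀ w : M.toSubmodule, Ef ((q w : M.toSubmodule) : MvPolynomial _ ℂ) =
      Ef (w : MvPolynomial (DegIdx σ m) ℂ) := by
    intro w
    have hqw : q w = wpart w := by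
      change ((Submodule.projectionOnto C.toSubmodule K.toSubmodule hKC'.symm w :
        C.toSubmodule) : M.toSubmodule) = wpart w
      conv_lhs => rw [← hsum w]
      rw [map_add, Submodule.projectionOnto_apply_of_mem_right hKC'.symm (hkpart w),
        Submodule.projectionOnto_apply_of_mem_left hKC'.symm (hwpart w), zero_add]
    have hk : Ef ((kpart w : M.toSubmodule) : MvPolynomial _ ℂ) = 0 := (hKmem _).mp (hkpart w)
    rw [hqw]
    conv_rhs => rw [← hsum w, Submodule.coe_add, map_add, hk, zero_add]
  -- the EQUIVARIANT lifts `L i : V^* → C ⊆ ℂ[Sym^m]_{≤D}`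
  let L : Fin (Module.finrank ℂ T) → Module.Dual ℂ V →ₗ[ℂ] MvPolynomial (DegIdx σ m) ℂ :=
    fun i => M.toSubmodule.subtype ∘ₗ q ∘ₗ LinearMap.codRestrict M.toSubmodule (ℓ₀ i) (hℓ₀D i)
  have hL_apply : ∀ i μ, L i μ = ((q ⟨ℓ₀ i μ, hℓ₀D i μ⟩ : M.toSubmodule) : MvPolynomial _ ℂ) :=
    fun i μ => rfl
  have hLE : ∀ i μ s, Ef (L i μ) s = μ (ρ (s : GL σ ℂ) (bT i : V)) := fun i μ s => by
    rw [hL_apply, hq_eval]; exact hℓ₀E i μ s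
  have hLequiv : ∀ i (γ : ↥SL) (μ : Module.Dual ℂ V),
      L i (μ ∘ₗ ρ ((γ⁻¹ : ↥SL) : GL σ ℂ)) = coordSubst m (γ : GL σ ℂ) (L i μ) := by
    intro i γ μ
    have ha : q ⟨ℓ₀ i (μ ∘ₗ ρ ((γ⁻¹ : ↥SL) : GL σ ℂ)), hℓ₀D i _⟩ ∈ C.toSubmodule := hq_mem _
    have hb : τ γ (q ⟨ℓ₀ i μ, hℓ₀D i μ⟩) ∈ C.toSubmodule := C.apply_mem_toSubmodule γ (hq_mem _)
    have heq := hinjC _ _ ha hb (by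
      funext s
      calc Ef ((q ⟨ℓ₀ i (μ ∘ₗ ρ ((γ⁻¹ : ↥SL) : GL σ ℂ)), hℓ₀D i _⟩ : M.toSubmodule) :
              MvPolynomial (DegIdx σ m) ℂ) s
          = (μ ∘ₗ ρ ((γ⁻¹ : ↥SL) : GL σ ℂ)) (ρ (s : GL σ ℂ) (bT i : V)) := by
              rw [← hL_apply, hLE]
        _ = μ (ρ ((γ⁻¹ * s : ↥SL) : GL σ ℂ) (bT i : V)) := by
              rw [LinearMap.comp_apply, ← Module.End.mul_apply, ← map_mul, Subgroup.coe_mul]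
        _ = Ef (L i μ) (γ⁻¹ * s) := by rw [hLE]
        _ = Ef (coordSubst m (γ : GL σ ℂ) (L i μ)) s := (hEf_coordSubst γ s (L i μ)).symm
        _ = Ef ((τ γ (q ⟨ℓ₀ i μ, hℓ₀D i μ⟩) : M.toSubmodule) :
              MvPolynomial (DegIdx σ m) ℂ) s := by rw [hτ_coe, hL_apply])
    rw [hL_apply, heq, hτ_coe, ← hL_apply]
  -- the vectors `p' i ∈ V = V^{**}`: `μ (p' i) = (L i μ)(g)`
  let θ : Fin (Module.finrank ℂ T) → Module.Dual ℂ (Module.Dual ℂ V) := fun i =>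
    (aeval (formCoeff m g) : MvPolynomial (DegIdx σ m) ℂ →ₐ[ℂ] ℂ).toLinearMap ∘ₗ L i
  let p' : Fin (Module.finrank ℂ T) → V := fun i => (Module.evalEquiv ℂ V).symm (θ i)
  have hp'_apply : ∀ i (μ : Module.Dual ℂ V), μ (p' i) = aeval (formCoeff m g) (L i μ) :=
    fun i μ => Module.apply_evalEquiv_symm_apply ℂ V μ (θ i)
  have hp'E : ∀ i (s : ↥SL) (μ : Module.Dual ℂ V), μ (ρ (s : GL σ ℂ) (p' i)) = Eg (L i μ) s := by
    intro i s μ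
    have h1 : μ (ρ (s : GL σ ℂ) (p' i)) = (μ ∘ₗ ρ (((s⁻¹)⁻¹ : ↥SL) : GL σ ℂ)) (p' i) := by
      rw [inv_inv, LinearMap.comp_apply]
    rw [h1, hp'_apply, hLequiv, aeval_formCoeff_coordSubst, hEg_apply, Subgroup.coe_inv, inv_inv]
  -- the linear map `Ψ t = ∑ i, (bT-coordinates of t) i • p' i`
  let Ψ : T →ₗ[ℂ] V := ∑ i, (bT.coord i).smulRight (p' i)
  have hΨ_apply : ∀ t, Ψ t = ∑ i, bT.coord i t • p' i := fun t => by
    simp only [Ψ, LinearMap.sum_apply, LinearMap.smulRight_apply]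
  have hΨE : ∀ (t : T) (s : ↥SL) (μ : Module.Dual ℂ V),
      μ (ρ (s : GL σ ℂ) (Ψ t)) = Eg (∑ i, bT.coord i t • L i μ) s := by
    intro t s μ
    rw [hΨ_apply, map_sum, map_sum, map_sum, Finset.sum_apply]
    exact Finset.sum_congr rfl fun i _ => by
      rw [map_smul, map_smul, smul_eq_mul, map_smul, Pi.smul_apply, smul_eq_mul, hp'E]
  refine ⟨Ψ, ?_, fun t => ?_⟩
  · -- injectivity: the hypothesis `SL·f ⊆ \overline{SL·g}` on the lifted polynomials
    rw [injective_iff_map_eq_zero]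
    intro t ht
    have hEg0 : ∀ μ : Module.Dual ℂ V, Eg (∑ i, bT.coord i t • L i μ) = 0 := by
      intro μ
      funext s
      rw [← hΨE t s μ, Pi.zero_apply, ht, map_zero, map_zero]
    have hEf0 : ∀ (μ : Module.Dual ℂ V) (s : ↥SL), μ (ρ (s : GL σ ℂ) (t : V)) = 0 := by
      intro μ s
      have h0 := congrFun (hR' _ (hEg0 μ)) s
      rw [map_sum, Finset.sum_apply, Pi.zero_apply] at h0
      simp_rw [map_smul, Pi.smul_apply, smul_eq_mul, hLE] at h0
      calc μ (ρ (s : GL σ ℂ) (t : V))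
          = μ (ρ (s : GL σ ℂ) ((∑ i, bT.repr t i • bT i : T) : V)) := by rw [bT.sum_repr]
        _ = ∑ i, bT.coord i t * μ (ρ (s : GL σ ℂ) (bT i : V)) := by
            simp only [Submodule.coe_sum, Submodule.coe_smul, map_sum, map_smul, smul_eq_mul,
              Module.Basis.coord_apply]
        _ = 0 := h0
    have ht0 : (t : V) = 0 := by
      refine (Module.forall_dual_apply_eq_zero_iff ℂ (t : V)).mp fun μ => ?_
      have h1 := hEf0 μ 1
      rwa [OneMemClass.coe_one, map_one, Module.End.one_apply] at h1
    exact Subtype.ext ht0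
  · -- `Ψ t` is `Q`-invariant (the `g` side)
    refine invariant_of_orbitPullback (m := m) ρ fun μ => ?_
    exact ⟨∑ i, bT.coord i t • L i μ, fun s => by rw [hΨE, hEg_apply]⟩

end Modules

/-! ### § 3 The multiplicity inequality for every rational module -/

section Main

variable {σ : Type} [Fintype σ] [LinearOrder σ]

/-- **The multiplicity inequality along an `SL`-degeneration, every rational module**: for `f`
polystable of degree `m` with `SL·f ⊆ \overline{SL·g}` (function form) and every finite-dimensional
rational `GL_σ(ℂ)`-module `(V, ρ)`, `dim V^{SL ∩ G_f} ≤ dim V^{SL ∩ G_g}`.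
[cite: MulmuleySohoniSIAM2001, Thm. 5.1 (AV p.20, all.txt L1365–1390; journal Thm. 5.1)] -/
theorem finrank_invariants_le_of_orbitPullback {f g : MvPolynomial σ ℂ} {m : ℕ}
    (hf : f.IsHomogeneous m) (hst : IsPolystable f)
    (hR : ∀ F : MvPolynomial (DegIdx σ m) ℂ,
      (∀ s : ↥(slSubgroup σ ℂ), aeval (formCoeff m (linSubstRep σ ℂ (s : GL σ ℂ) g)) F = 0) →
      ∀ s : ↥(slSubgroup σ ℂ), aeval (formCoeff m (linSubstRep σ ℂ (s : GL σ ℂ) f)) F = 0)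
    {V : Type*} [AddCommGroup V] [Module ℂ V] [FiniteDimensional ℂ V]
    (ρ : Representation ℂ (GL σ ℂ) V) (hρ : IsRationalRep ρ) :
    Module.finrank ℂ (Representation.invariants (ρ.comp (slSubgroup σ ℂ ⊓ linStabilizer f).subtype)) ≤
      Module.finrank ℂ (Representation.invariants (ρ.comp (slSubgroup σ ℂ ⊓ linStabilizer g).subtype)) := by
  set Tf := Representation.invariants (ρ.comp (slSubgroup σ ℂ ⊓ linStabilizer f).subtype) with hTf
  set Tg := Representation.invariants (ρ.comp (slSubgroup σ ℂ ⊓ linStabilizer g).subtype) with hTg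
  have hmemf : ∀ v ∈ Tf, ∀ γ ∈ slSubgroup σ ℂ ⊓ linStabilizer f, ρ γ v = v :=
    fun v hv γ hγ => (Representation.mem_invariants _ v).mp hv ⟨γ, hγ⟩
  obtain ⟨Ψ, hΨinj, hΨmem⟩ := exists_injective_linearMap_invariants_of_orbitPullback hR ρ Tf
    (fun v hv μ => exists_orbitPullback_of_mem_invariants hf hst ρ hρ (hmemf v hv) μ)
  have hrange : LinearMap.range Ψ ≤ Tg := by
    rintro _ ⟨t, rfl⟩
    exact (Representation.mem_invariants _ _).mpr fun γ => hΨmem t γ γ.2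
  calc Module.finrank ℂ Tf = Module.finrank ℂ (LinearMap.range Ψ) :=
        (LinearMap.finrank_range_of_inj hΨinj).symm
    _ ≤ Module.finrank ℂ Tg := Submodule.finrank_mono hrange

/-- **GCT I (Mulmuley–Sohoni 2001), Thm. 5.1, multiplicity form, EVERY finite-dimensional rational
module, over `ℂ` — PROVED**: «the multiplicity of the trivial `Q`-representation in any `G`-module
must exceed that of the trivial `H`-representation» (AV p. 20 L1388–1390) whenever `f` (polystable,
stabiliser `H = SL ∩ G_f`) lies in the orbit closure `Δ[g]` (`Q = SL ∩ G_g`): for every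
finite-dimensional rational `GL_σ(ℂ)`-module `(V, ρ)`, `dim V^{H} ≤ dim V^{Q}`. Cases `f = 0` and
`m = 0` are immediate; otherwise cone reduction (§ 1) and `finrank_invariants_le_of_orbitPullback`
for `c • f`. [cite: MulmuleySohoniSIAM2001, Thm. 5.1 (AV p.20, all.txt L1365–1390; journal Thm. 5.1)] -/
theorem finrank_invariants_le_of_mem_orbitClosure {f g : MvPolynomial σ ℂ} {m : ℕ}
    (hf : f.IsHomogeneous m) (hg : g.IsHomogeneous m) (hst : IsPolystable f)
    (hmem : f ∈ orbitClosure g)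
    {V : Type*} [AddCommGroup V] [Module ℂ V] [FiniteDimensional ℂ V]
    (ρ : Representation ℂ (GL σ ℂ) V) (hρ : IsRationalRep ρ) :
    Module.finrank ℂ (Representation.invariants (ρ.comp (slSubgroup σ ℂ ⊓ linStabilizer f).subtype)) ≤
      Module.finrank ℂ (Representation.invariants (ρ.comp (slSubgroup σ ℂ ⊓ linStabilizer g).subtype)) := by
  classical
  -- `f = 0`: `H = SL ⊇ Q`
  by_cases hf0 : f = 0
  · subst hf0
    refine Submodule.finrank_mono fun v hv => ?_
    refine (Representation.mem_invariants _ v).mpr fun γ => ?_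
    have hγ' : (γ : GL σ ℂ) ∈ slSubgroup σ ℂ ⊓ linStabilizer (0 : MvPolynomial σ ℂ) :=
      Subgroup.mem_inf.mpr ⟨(Subgroup.mem_inf.mp γ.2).1, by rw [mem_linStabilizer, map_zero]⟩
    exact (Representation.mem_invariants _ v).mp hv ⟨γ, hγ'⟩
  -- `m = 0`: constants, `G_f = G_g = GL`
  rcases Nat.eq_zero_or_pos m with hm | hm
  · subst hm
    have hC : ∀ {q : MvPolynomial σ ℂ}, q.IsHomogeneous 0 → linStabilizer q = ⊤ := by
      intro q hq
      have hq0 : q = C (q.coeff 0) :=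
        totalDegree_eq_zero_iff_eq_C.mp (Nat.le_zero.mp hq.totalDegree_le)
      ext γ
      simp only [mem_linStabilizer, Subgroup.mem_top, iff_true]
      rw [hq0, linSubstRep_apply, algHom_C, algebraMap_eq]
    rw [hC hf, hC hg]
  -- `σ` is non-empty (a non-zero form of positive degree has a variable)
  have hσ : 0 < Fintype.card σ := by
    rw [Fintype.card_pos_iff]
    by_contra hσe
    rw [not_nonempty_iff] at hσe
    exact hf0 (hf.inj_right (isHomogeneous_of_isEmpty σ ℂ f) hf0 ▸ hm).false.elim
  -- cone reduction and the `SL`-degeneration inequality for `c • f`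
  obtain ⟨c, hc, hz⟩ :=
    exists_smul_mem_zariskiClosure_slOrbit_of_mem_orbitClosure' hσ hf hg hf0 hst hmem
  have hcf : (c • f).IsHomogeneous m :=
    (mem_homogeneousSubmodule m _).mp
      ((homogeneousSubmodule σ ℂ m).smul_mem c ((mem_homogeneousSubmodule m f).mpr hf))
  have hle := finrank_invariants_le_of_orbitPullback hcf (hst.const_smul hc)
    (orbitPullback_eq_zero_of_mem_zariskiClosure_slOrbit hz) ρ hρ
  rwa [linStabilizer_smul hc] at hle

/-- **GCT I, Thm. 5.1, «`W` is an obstruction for `(f, g)`», every finite-dimensional rational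
module, over `ℂ`**: if `f` is a polystable form of degree `m`, `g` a form of degree `m`, and some
finite-dimensional rational `GL_σ(ℂ)`-module `V` has `dim V^{SL ∩ G_g} < dim V^{SL ∩ G_f}`, then
`f ∉ Δ[g] = \overline{GL·g}`. (MS's `TODO(general form)` of the typed fact `MS2001_thm_5_1`, over
`ℂ`; the case `V = Sym^r` is `MS2001_thm_5_1_complex`.)
[cite: MulmuleySohoniSIAM2001, Thm. 5.1 (AV p.20, all.txt L1365–1390; journal Thm. 5.1)] -/
theorem MS2001_thm_5_1_modules_complex {f g : MvPolynomial σ ℂ} {m : ℕ}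
    (hf : f.IsHomogeneous m) (hg : g.IsHomogeneous m) (hst : IsPolystable f)
    {V : Type*} [AddCommGroup V] [Module ℂ V] [FiniteDimensional ℂ V]
    (ρ : Representation ℂ (GL σ ℂ) V) (hρ : IsRationalRep ρ)
    (h : Module.finrank ℂ (Representation.invariants (ρ.comp (slSubgroup σ ℂ ⊓ linStabilizer g).subtype)) <
      Module.finrank ℂ (Representation.invariants (ρ.comp (slSubgroup σ ℂ ⊓ linStabilizer f).subtype))) :
    f ∉ orbitClosure g := fun hmem =>
  (finrank_invariants_le_of_mem_orbitClosure hf hg hst hmem ρ hρ).not_gt h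

/-- **Frobenius reciprocity for the closed orbit, as an equivalence** (GCT II, proof of Prop. 5.2,
main.tex L1130–1150: the algebraic Peter–Weyl decomposition `ℂ[G/H] = ⊕_S S ⊗ (S^*)^H` — the
`S`-isotypic part of `ℂ[G·v̂] = ℂ[G]^H` is indexed by the `H`-invariants; Grosshans §1): for a
polystable form `f` of degree `m` and a finite-dimensional rational `GL_σ(ℂ)`-module `(V, ρ)`, a
vector `v` is fixed by `SL ∩ G_f` IF AND ONLY IF all its matrix coefficients `s ↦ μ(ρ(s) v)` are
pull-backs of polynomials along `SL·f` (§ 2: `exists_orbitPullback_of_mem_invariants` and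
`invariant_of_orbitPullback` with `g = f`). So the `f`-realisable vectors are exactly `V^{SL ∩ G_f}`,
i.e. the inequality chain of this file is sharp at `g = f`.
[cite: MulmuleySohoniGCT2SIAM2008, Prop. 5.2, proof (arXiv cs/0612134 main.tex L1130–1150)]
[cite: Grosshans1997, §1 (`k[G/H] = k[G]^H`, Frobenius reciprocity)] -/
theorem invariant_iff_orbitPullback {f : MvPolynomial σ ℂ} {m : ℕ}
    (hf : f.IsHomogeneous m) (hst : IsPolystable f)
    {V : Type*} [AddCommGroup V] [Module ℂ V] (ρ : Representation ℂ (GL σ ℂ) V)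
    (hρ : IsRationalRep ρ) (v : V) :
    (∀ γ ∈ slSubgroup σ ℂ ⊓ linStabilizer f, ρ γ v = v) ↔
      ∀ μ : Module.Dual ℂ V, ∃ F : MvPolynomial (DegIdx σ m) ℂ, ∀ s : ↥(slSubgroup σ ℂ),
        μ (ρ (s : GL σ ℂ) v) = aeval (formCoeff m (linSubstRep σ ℂ (s : GL σ ℂ) f)) F :=
  ⟨fun hv μ => exists_orbitPullback_of_mem_invariants hf hst ρ hρ hv μ,
    fun h => invariant_of_orbitPullback (m := m) ρ h⟩

end Main

end Literature.Computability.AlgebraicComplexity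

end
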